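import Summits.ABC.StewartYu.PadicG3TwoSchedule
import Summits.ABC.StewartYu.PadicG3ParC
import HarnessLib

/-!
# Cell abc-stewartyu, Gen-3 record at `p = 2` (crux `Y07Two`, stmt-ABC-19659): the budget line (L1) of p5's
# `frameNumericsTwoC_schedTwo` — the binomial Siegel count of the schedule `σ₂` — DISCHARGED from `PadicG3ParC.siegel_count`

`Summits/ABC/StewartYu/PadicG3TwoRecordL1.lean` — seat p1 (g7), record (WP-M3.R); theorems only.
p5's `TwoSetup.frameNumericsTwoC_schedTwo` (p487512) takes four record inputs: the depth fit, (L1), (L2), (L3).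
(L1) reads, on the projections of `schedTwo S P`,
`2·2^m·((2·N0 0 + 1)·C(T0 0 + d, d+1)) ≤ (L₀+1)·(∏ⱼ (2·Dbox 0 j + 1))·(2·Dθ 0 + 1)`.
Here: `N0 0 = X`, `T0 0 = ⌊M/(n+2)³⌋ + 8(n+2)L + 1 ≤ Mord 0 0 + 1` (`n = d + 1`), `Dbox 0 j = side j + 1`, `2^m ≤ p^m·K₀ = K`,
so (L1) is `PadicG3Par.siegel_count` at `M′ := T0 0 − 1` followed by two monotonicities.

WHAT THIS IS NOT: (L2)/(L3) (they need the diameter box, STATUS p1 2026-08-27T02:31Z); no crux moves.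

References: Yu. V. Nesterenko, LNM 1819 (2003), Prop 3.9 (3.48).
-/

noncomputable section

open Finset

namespace Summit.ABC.StewartYu

namespace TwoSetup

variable (S : TwoSetup) (P : PadicG3Par (S.d + 1))

/-- At level `0` the box of `σ₂` is `side j + 1`. [folklore] -/
theorem Dbox3_zero (j : Fin S.d) : S.Dbox3 P 0 j = P.side (Fin.castSucc j) + 1 := by
  unfold Dbox3 PadicG3Par.side; simp

/-- At level `0` the `θ`-box of `σ₂` is `side last + 1`. [folklore] -/
theorem Dθ3_zero : S.Dθ3 P 0 = P.side (Fin.last S.d) + 1 := by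
  unfold Dθ3 PadicG3Par.side; simp

/-- The record's box count is below `σ₂`'s: `∏ⱼ (2 side j + 1) ≤ (∏_{j<d} (2 Dbox3 0 j + 1))·(2 Dθ3 0 + 1)`. [folklore] -/
theorem prod_side_le_prod_Dbox3 :
    ∏ j : Fin (S.d + 1), (2 * P.side j + 1) ≤
      (∏ j : Fin S.d, (2 * S.Dbox3 P 0 j + 1)) * (2 * S.Dθ3 P 0 + 1) := by
  rw [Fin.prod_univ_castSucc]
  refine Nat.mul_le_mul (Finset.prod_le_prod' fun j _ => ?_) ?_
  · rw [S.Dbox3_zero P j]; omega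
  · rw [S.Dθ3_zero P]; omega

/-- The start order of `σ₂` is within the record's level-`0` order: `T03 0 − 1 ≤ Mord 0 0`
(`8(n+2) L ≤ 16(n+1) L`). [cite: Nesterenko2003, (4.5)] -/
theorem T03_zero_sub_one_le_Mord : S.T03 P 0 - 1 ≤ P.Mord 0 0 := by
  have hn : S.d + 1 + 2 = S.d + 3 := by omega
  have h : 2 * (S.d + 3) * (4 * P.L) ≤ 8 * P.L * (2 * (S.d + 1 + 1)) := by nlinarith
  have h1 : S.T03 P 0 - 1 = P.M / (S.d + 3) ^ 3 + 2 * (S.d + 3) * (4 * P.L) := by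
    unfold T03 T3; simp [hn]
  have h2 : P.Mord 0 0 = P.M / (S.d + 3) ^ 3 + 8 * P.L * (2 * (S.d + 1 + 1)) := by
    unfold PadicG3Par.Mord PadicG3Par.T; simp [hn]
  rw [h1, h2]
  exact Nat.add_le_add_left h _

/-- **(L1) OF `frameNumericsTwoC_schedTwo`: the binomial Siegel count of the `p = 2` schedule.**
[cite: Nesterenko2003, Prop 3.9 (3.48)] -/
theorem hL1_schedTwo :
    2 * 2 ^ (S.schedTwo P).m *
        ((2 * (S.schedTwo P).N0 0 + 1) * ((S.schedTwo P).T0 0 + S.d).choose (S.d + 1)) ≤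
      (P.L₀ + 1) * ((∏ j, (2 * (S.schedTwo P).Dbox 0 j + 1)) * (2 * (S.schedTwo P).Dθ 0 + 1)) := by
  simp only [schedTwo_m, schedTwo_N0, Nsub3_zero_zero, schedTwo_T0, schedTwo_Dbox, schedTwo_Dθ]
  have hM := S.T03_zero_sub_one_le_Mord P
  have h := P.siegel_count hM
  have e : S.T03 P 0 - 1 + (S.d + 1) = S.T03 P 0 + S.d := by have := S.one_le_T03 P 0; omega
  rw [e] at h
  have hK : 2 ^ P.m ≤ P.K := by
    unfold PadicG3Par.K
    calc 2 ^ P.m ≤ P.p ^ P.m := Nat.pow_le_pow_left P.hp _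
      _ ≤ P.p ^ P.m * P.K₀ := Nat.le_mul_of_pos_right _ (by have := P.hK₀; omega)
  have hbox := S.prod_side_le_prod_Dbox3 P
  calc 2 * 2 ^ P.m * ((2 * P.X + 1) * (S.T03 P 0 + S.d).choose (S.d + 1))
      = 2 * (2 * P.X + 1) * (S.T03 P 0 + S.d).choose (S.d + 1) * 2 ^ P.m := by ring
    _ ≤ 2 * (2 * P.X + 1) * (S.T03 P 0 + S.d).choose (S.d + 1) * P.K := Nat.mul_le_mul_left _ hK
    _ ≤ (P.L₀ + 1) * ∏ j : Fin (S.d + 1), (2 * P.side j + 1) := h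
    _ ≤ (P.L₀ + 1) * ((∏ j : Fin S.d, (2 * S.Dbox3 P 0 j + 1)) * (2 * S.Dθ3 P 0 + 1)) :=
        Nat.mul_le_mul_left _ hbox

end TwoSetup

end Summit.ABC.StewartYu

end
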